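import Summits.KontsevichZagierPeriods.KontsevichZagierPeriods.Theorems.TerasomaMultiplicationBetaCancellationOfAyoubPiCancellation
import Summits.KontsevichZagierPeriods.KontsevichZagierPeriods.Theorems.TerasomaMultiplicationBetaCancellationOpenSquare
import Summits.KontsevichZagierPeriods.KontsevichZagierPeriods.Theorems.TerasomaMultiplicationBetaCancellationEvalSector
import Summits.KontsevichZagierPeriods.KontsevichZagierPeriods.Theorems.TerasomaMultiplicationBetaCancellationWeight2Descent
import Summits.KontsevichZagierPeriods.KontsevichZagierPeriods.Theorems.TerasomaMultiplicationBetaCancellationCatalyticProductDescent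
import Summits.KontsevichZagierPeriods.KontsevichZagierPeriods.Theorems.TerasomaMultiplicationBetaCancellationTwoPieceFibreSubstitution
import Summits.KontsevichZagierPeriods.KontsevichZagierPeriods.Theorems.TerasomaMultiplicationBetaCancellationAEConstAlgebraic
import Summits.KontsevichZagierPeriods.KontsevichZagierPeriods.Theorems.TerasomaMultiplicationBetaCancellationScaledJacobian
import Summits.KontsevichZagierPeriods.KontsevichZagierPeriods.Theorems.TerasomaMultiplicationBetaCancellationSwapSubstitutionAE
import Summits.KontsevichZagierPeriods.KontsevichZagierPeriods.Theorems.TerasomaMultiplicationBetaCancellationTwoPieceFibreSubstitutionAnyFractions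
import Summits.KontsevichZagierPeriods.KontsevichZagierPeriods.Theorems.TerasomaMultiplicationBetaCancellationSwapSubstitution
import Literature.NumberTheory.Transcendental.KZRelationsLE

/-!
# `BetaCancellation` (stmt-KontsevichZagierPeriods-13633) — line `dirichlet-companion-to-pi`, skeleton v15 (lead seat c21, 2026-08-17T02:15Z: body = v11 of seat c16 / v14 of c20, header re-owned; the single `sorry` is item stmt-KontsevichZagierPeriods-0540 = the Literature `@[conjecture] KZ.PiCancellation` by the tree theorem `betaCancellation_iff_piCancellation`; 0540 re-verified open/unclaimed at 02:12Z)

**State of the crux (all statements referred to below are TREE THEOREMS; the single `sorry` is item 0540 verbatim).**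

The crux (two-term pinned Beta cancellation: for `0 < a, b ∈ ℚ`, `q = β(a,b) ⊗ r`, `q' = β(a,b) ⊗ r'`
pinned, `q ∼ q' → r ∼ r'`) is EQUIVALENT to the `π`-cancellation item stmt-KontsevichZagierPeriods-0540
(`AyoubPiCancellation` ≡ `KZ.PiCancellation`): `betaCancellation_iff_ayoubPiCancellation`,
`betaCancellation_iff_piCancellation` (…OfAyoubPiCancellation / …OfPiCancellation),
`BetaCancellationNegative.piCancellation_of_betaCancellation` (Negative/PiLink: 0540 is NECESSARY).
So `BetaCancellation_of` below is the landed bridge applied to ONE stub, `stub_piCancellation`, whose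
type is the route declaration of item 0540 BY NAME. Nothing else in this crux is open:

* DECIDED INSIDE THE CALCULUS (seat c13): `betaCancellation_of_int_or_int` — ONE INTEGER EXPONENT
  SUFFICES (…OneIntegerExponent, p128817); both integer: `BetaCancellationNegative.betaCancellation_of_int`.
* THE OPEN CORE LOCALISED (seat c13): `betaCancellation_iff_half` (the crux ↔ its SINGLE instance
  `a = b = 1/2`), `betaCancellation_iff_antidiagonal`, `betaCancellation_iff_openTriangle` (…OpenCore p128783,
  …OpenSquare p128996).
* EVAL SECTORS (seats c10/c13): `kernelCancellation_of_valueRigid`, `betaCancellation_of_dim_le_one_rational`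
  (…EvalSector p129007).
* CERTIFICATE CLASSES for which `π`-cancellation — hence the crux — is PROVED (seats c7–c9, c14): fibred,
  wall-respecting, side/region-compatible, weight- and weight2-compatible certificates
  (`fibred_ayoubPiCancellation`, `wall_ayoubPiCancellation`, `sideDescent`, `weightDescent`,
  `weight2_ayoubPiCancellation`; crux versions `betaCancellation_iff_{fibred,wall,side,weight,weight2}Reduction`,
  `betaCancellation_of_weightCompatible`, `betaCancellation_of_fibredCertificate`); CATALYTIC PRODUCT
  CERTIFICATES for every catalyst of non-zero value (`stub_fibreSubstitution`,
  `betaCancellation_of_fibreSubstitution`, `stub_catalyticNewtonLeibnizDescent`, `stub_catalyticProductDescent`,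
  `piCancellation_of_catalyticProductCertificate`, `betaCancellation_of_catalyticProductCertificate`,
  catalyst exchange `stub_fibreSubstitutionTwoCatalysts` p131872, two-piece fibre form with algebraic
  catalyst fractions `stub_twoPieceFibreSubstitution` p132265).

What is open is exactly item 0540 (effective-vs-`2πi`-localised injectivity of formal periods;
Huber–Wüstholz 2022 App. A.4, Ayoub 2015 Rem. 1.3): the registered stub below.
-/

noncomputable section

-- `Summit.KontsevichZagierPeriods.KontsevichZagierPeriods.…` is the tree's mandated layout (single-conjunct summit).
set_option linter.dupNamespace false

namespace Summit.KontsevichZagierPeriods.KontsevichZagierPeriods.BetaCancellationLine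

open MeasureTheory
open Literature.NumberTheory.Transcendental
open Literature.NumberTheory.Transcendental.KZ

/-! ## The one registered open stub: item 0540 by name -/

/-- STUB (THE OPEN CORE — item stmt-KontsevichZagierPeriods-0540 VERBATIM, by name): `π`-cancellation
for the pinned disc family, `AyoubPiCancellation` (≡ `KZ.PiCancellation`: `[π]·c ∈ relations → c ∈ relations`).
Necessary (`piCancellation_of_betaCancellation`) and sufficient (`betaCancellation_of_ayoubPiCancellation`)
for the crux. [folklore] -/
theorem stub_piCancellation :
    Summit.KontsevichZagierPeriods.KontsevichZagierPeriods.Theses.AyoubSpecialisation.AyoubPiCancellation := by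
  sorry

/-! ## Sanity: the landed pieces compose (no sorry below this line except through the stub) -/

/-- The open core in Beta dress: every instance on the open triangle `0 < a ≤ b < 1` follows from the
stub (0540 ⟹ the crux ⟹ its instances). [folklore] -/
theorem openTriangle_of_stub :
    ∀ a b : ℚ, 0 < a → a ≤ b → b < 1 →
      Summit.KontsevichZagierPeriods.KontsevichZagierPeriods.BetaCancellationNegative.KernelCancellation
        (Summit.KontsevichZagierPeriods.KontsevichZagierPeriods.BetaCancellationNegative.betaKernel a b) :=
  betaCancellation_iff_openTriangle.1 (betaCancellation_of_ayoubPiCancellation stub_piCancellation)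

/-- Sanity (imported, seat c14): the crux's literal hypotheses at ALL exponents with `q ∼ q'` replaced by
one fibre-form substitution give `r ∼ r'`. [folklore] -/
example := @betaCancellation_of_fibreSubstitution

/-- Sanity (imported, seat c14): catalytic product certificates of the Beta family descend, all exponents. [folklore] -/
example := @betaCancellation_of_catalyticProductCertificate

/-- Sanity (imported, seat c14 cycle 4): two-piece fibre-form substitutions with algebraic catalyst fractions descend. [folklore] -/
example := @stub_twoPieceFibreSubstitution

/-! ## Seat c15: THE ARITHMETIC OF ONE-MOVE CERTIFICATES — constants forced into an a.e. identity between
`ℚ`-semialgebraic integrands are ALGEBRAIC (all LANDED, imported above)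

A one-move change of variables between pinned products compares catalyst masses (periods: a disc segment, an
incomplete Beta value, the ratio of two catalyst values) with `ℚ`-semialgebraic integrands through an a.e. identity
`c · f = (f' ∘ ψ)|det ψ'|`. An a.e.-constant `ℚ`-semialgebraic function has an algebraic value
(`isAlgebraic_of_ae_eq_const`, …AEConstAlgebraic p133184), so every such constant is algebraic as soon as the base is
not null (`isAlgebraic_of_ae_scaledJacobian`, `stub_catalystRatio_isAlgebraic`, …ScaledJacobian p133957): the
algebraicity HYPOTHESES of seat c14's catalyst exchange / two-piece theorems are automatic
(`stub_twoPieceFibreSubstitution_anyFractions`, …TwoPieceFibreSubstitutionAnyFractions), the "transcendental catalyst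
fraction" layer of the one-move residual (crux notes c14 K4/K5 (iv)/K8 (vi)) is EMPTY, and SWAP certificates — the maximal
tilt of the catalyst axis into the base, `head∘Φ = α∘tail`, `tail∘Φ = β∘head` — descend (`stub_swapSubstitutionAE`
p133703, `stub_swapSubstitution`, …SwapSubstitution): `r ∼ (r.value/p.value)·p ∼ r'` with an ALGEBRAIC scale. -/

/-- Sanity (imported, seat c15): an a.e.-constant `ℚ`-semialgebraic function has an algebraic value. [folklore] -/
example := @isAlgebraic_of_ae_eq_const

/-- Sanity (imported, seat c15): catalyst value ratios of one fibre-form move are algebraic unless the base is null. [folklore] -/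
example := @stub_catalystRatio_isAlgebraic

/-- Sanity (imported, seat c15, p134257): two-piece fibre-form substitutions descend with NO algebraicity hypothesis on the
catalyst fractions (they are forced algebraic). [folklore] -/
example := @stub_twoPieceFibreSubstitution_anyFractions

/-- Sanity (imported, seat c15, p134293): swap substitutions (maximal tilt of the catalyst axis) descend. [folklore] -/
example := @stub_swapSubstitution

/-- Sanity (imported, seat c15): the measure core of swap substitutions. [folklore] -/
example := @stub_swapSubstitutionAE

/-! ## The crux -/

/-- **Line `dirichlet-companion-to-pi` closes the crux** from the single open stub (item 0540) through
the landed bridge `betaCancellation_of_ayoubPiCancellation`. [folklore] -/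
theorem BetaCancellation_of :
    Summit.KontsevichZagierPeriods.KontsevichZagierPeriods.Theses.TerasomaMultiplication.BetaCancellation :=
  betaCancellation_of_ayoubPiCancellation stub_piCancellation

end Summit.KontsevichZagierPeriods.KontsevichZagierPeriods.BetaCancellationLine
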